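import Summits.RiemannHypothesis.RiemannHypothesis.Theorems.PfPersistenceGalerkinFloorTransfer
import Summits.RiemannHypothesis.RiemannHypothesis.Theorems.PfPersistenceGalerkinClosedFormIdentity
import HarnessLib

/-!
# GAL-1 RE-TYPED IN GALERKIN COORDINATES: the floor transfer needs ONE density input, not the window-matrix identity (pub-rhpf, barrier-typer gen 4)

**HONEST FRAMING. This is a long-odds MECHANISM SEARCH; no RH claims.** RH-free bookkeeping between the cell's
Galerkin records and the continuum model. The named `Prop`s are STATEMENTS (targets, label TYPED); the reductions
are PROVED; the last corollary is the G1.05 / G1.14 THERMOMETER REDUCTION (RH-strength label, E1): it derives RH from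
a floor hypothesis nobody has and a density statement nobody has proved, and asserts nothing about either.

cand-3 (gen 5, 2026-08-19T13:01Z) settled GAL-0 (i): the normalising constant is `c = 1`
(`galerkinForm_eq_closedForm`, `galerkin_norm_identity`), but the typed `GalerkinMatrixIdentity` is NOT provable
from the tree AS TYPED (its first conjunct evaluates `Re Q` — digamma archimedean term — at the non-smooth cut-off
profile; it is equivalent to the Markov decomposition at cut-off profiles, `galerkinMatrixIdentity_iff_markov_at_cutoff`).
The gen-3 transfer `PfPersistenceGalerkinFloorTransfer` used (i) only to READ `vᵀQv` and `vᵀv` as `Re Q(f_N)` and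
`∫|f_N|²`. Re-typing the density (ii′) directly in Galerkin coordinates removes (i) altogether:

* `TestToGalerkinFormDensity` (ii″, TYPED): every smooth even real test `g` on `[-a, a]` is approximated by SOME
  window vector `(N, v)` in mass `vᵀv ≈ ∫|g|²` and in form value `vᵀ(ζ-block at (a, N))v ≈ Re Q(g)`.
* `TestToClosedFormDensity` (ii‴, TYPED, the pure form-domain statement): the same with the Markov closed form
  `P(f) + 𝓔_a(f) − M_a‖f‖²` of the cut-off profile `f = cutoffProfile (a, N) v` in place of `vᵀQv` (informal route:
  Fourier truncation of the `2a`-periodised `g`; `P`, `𝓔_a`, mass are continuous in the form norm).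
* PROVED `testToGalerkinFormDensity_of_closedForm` : (ii‴) → (ii″) (cand-3's closed-form identity + Bombieri's
  decomposition `Re Q(g) = P(g) + 𝓔_a(g) − M_a‖g‖²` for smooth `g`);
  PROVED `testToGalerkinFormDensity_of_identity_of_density` : (i) → (ii′) → (ii″) (the gen-3 inputs imply the new one).
* PROVED from (ii″) ALONE: `re_weilQuadratic_ge_of_galerkinFloor'`, `galerkinToContinuum_of_galerkinDensity`,
  `neg_le_weilEvenGroundEnergy_of_galerkinFloor'`, `riemannHypothesis_of_galerkinFloors'` (the G1.05 / G1.14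
  reduction: Galerkin floors `-σ_k` at `a_k → ∞`, `σ_k → 0`, all truncations ⇒ RH, modulo (ii″) only).
* PROVED, the CONVERSE direction is unconditional (cand-3's GAL-0 with the full bottom): a continuum floor
  `-σ ≤ ε(a)` gives the Galerkin floor `-σ` at `a` for every truncation (`galerkinFloorAt_of_neg_le_weilGroundEnergy`).
  Direction check asked by cand-3: GAL-1 needs floors ⇒ continuum, i.e. density (ii″); `weilGroundEnergy_mul_le_galerkinForm`
  is the other direction and cannot replace it.
-/

set_option linter.dupNamespace false  -- the mandated namespace repeats `RiemannHypothesis`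

noncomputable section

open Set MeasureTheory Matrix Filter
open scoped Topology
open Literature.NumberTheory.LFunctions

namespace Summit.RiemannHypothesis.RiemannHypothesis.Theorems.PfPersistence

/-- **GAL-1 (ii″), TEST-TO-GALERKIN FORM DENSITY** (TYPED, statement only): for every genuine half-length `a`, every
smooth even real test `g` with `tsupport g ⊆ [-a, a]` and every `δ > 0` there are a truncation `N` and a window
vector `v` with `|vᵀv − ∫|g|²| ≤ δ` and `|vᵀ(ζ-block at (a, N))v − Re Q(g)| ≤ δ`. Replaces the pair
(`GalerkinMatrixIdentity`, `TestToProfileFormDensity`) of the gen-3 transfer. (A `Prop`, statement only.) -/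
def TestToGalerkinFormDensity : Prop :=
  ∀ (a : ℝ) (ha : 0 < a) (g : ℝ → ℂ), IsWeilTest g → tsupport g ⊆ Icc (-a) a → (∀ t, g (-t) = g t) →
    (∀ t, (g t).im = 0) → ∀ δ : ℝ, 0 < δ →
      ∃ (N : ℕ) (v : Fin (N + 1) → ℝ),
        |v ⬝ᵥ v - ∫ t, ‖g t‖ ^ 2| ≤ δ ∧ |v ⬝ᵥ (zetaDatum ⟨a, N, ha⟩ *ᵥ v) - (weilQuadratic g).re| ≤ δ

/-- the MARKOV CLOSED FORM `P(f) + 𝓔_a(f) − M_a ‖f‖²` of a function at half-length `a` (form-domain expression of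
`Re Q`; equals `Re Q(f)` for smooth tests on `[-a, a]`, Bombieri). [folklore] -/
def markovClosedForm (a : ℝ) (f : ℝ → ℂ) : ℝ :=
  weilPoleForm f + weilDirichletEnergy a f - weilMarkovConstant a * ∫ x, ‖f x‖ ^ 2

/-- PROVED (cand-3's closed-form identity, renamed): `vᵀ(ζ-block at win)v = markovClosedForm a (cutoffProfile win v)`. [folklore] -/
theorem galerkinForm_eq_markovClosedForm (win : Window) (v : Fin (win.N + 1) → ℝ) :
    v ⬝ᵥ (zetaDatum win *ᵥ v) = markovClosedForm win.a (cutoffProfile win v) :=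
  galerkinForm_eq_closedForm win v

/-- PROVED (Bombieri's decomposition, renamed): `Re Q(g) = markovClosedForm a g` for a smooth test on `[-a, a]`. [folklore] -/
theorem re_weilQuadratic_eq_markovClosedForm {g : ℝ → ℂ} (hg : IsWeilTest g) {a : ℝ}
    (hs : tsupport g ⊆ Icc (-a) a) : (weilQuadratic g).re = markovClosedForm a g :=
  weilQuadratic_re_eq_weilPoleForm_add_weilDirichletEnergy_sub hg hs

/-- **GAL-1 (ii‴), TEST-TO-PROFILE DENSITY IN THE CLOSED FORM** (TYPED, statement only; the pure form-domain
statement): smooth even real tests on `[-a, a]` are approximated by cut-off profiles `cutoffProfile (a, N) v` in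
mass and in the Markov closed form. (A `Prop`, statement only.) -/
def TestToClosedFormDensity : Prop :=
  ∀ (a : ℝ) (ha : 0 < a) (g : ℝ → ℂ), IsWeilTest g → tsupport g ⊆ Icc (-a) a → (∀ t, g (-t) = g t) →
    (∀ t, (g t).im = 0) → ∀ δ : ℝ, 0 < δ →
      ∃ (N : ℕ) (v : Fin (N + 1) → ℝ),
        |(∫ t, ‖cutoffProfile ⟨a, N, ha⟩ v t‖ ^ 2) - ∫ t, ‖g t‖ ^ 2| ≤ δ ∧
          |markovClosedForm a (cutoffProfile ⟨a, N, ha⟩ v) - markovClosedForm a g| ≤ δ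

/-- **PROVED — (ii‴) ⇒ (ii″):** the closed-form density gives the Galerkin-coordinate density (closed-form identity
for the profile side, Bombieri's decomposition for the smooth side, `galerkin_norm_identity` for the mass). [folklore] -/
theorem testToGalerkinFormDensity_of_closedForm (hD : TestToClosedFormDensity) : TestToGalerkinFormDensity := by
  intro a ha g hg hs hev hre δ hδ
  obtain ⟨N, v, hn, hq⟩ := hD a ha g hg hs hev hre δ hδ
  refine ⟨N, v, ?_, ?_⟩
  · rw [integral_norm_sq_cutoffProfile ⟨a, N, ha⟩ v] at hn
    exact hn
  · rw [← galerkinForm_eq_markovClosedForm ⟨a, N, ha⟩ v, ← re_weilQuadratic_eq_markovClosedForm hg hs] at hq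
    exact hq

/-- **PROVED — the gen-3 inputs imply the new one:** `GalerkinMatrixIdentity → TestToProfileFormDensity →
TestToGalerkinFormDensity`. [folklore] -/
theorem testToGalerkinFormDensity_of_identity_of_density (hI : GalerkinMatrixIdentity)
    (hD : TestToProfileFormDensity) : TestToGalerkinFormDensity := by
  intro a ha g hg hs hev hre δ hδ
  obtain ⟨N, v, hn, hq⟩ := hD a ha g hg hs hev hre δ hδ
  obtain ⟨hQ, hN⟩ := hI ⟨a, N, ha⟩ v
  exact ⟨N, v, by rwa [hN], by rwa [hQ]⟩

/-- **PROVED — GALERKIN FLOORS TRANSFER TO REAL EVEN TESTS (modulo (ii″) only):** a floor `-σ` (`σ ≥ 0`) on `ζ`'s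
even blocks at half-length `a` for every truncation gives `-σ·∫|g|² ≤ Re Q(g)` for every smooth even real test
`g` supported in `[-a, a]`. [folklore] -/
theorem re_weilQuadratic_ge_of_galerkinFloor' (hD : TestToGalerkinFormDensity) {a σ : ℝ} {ha : 0 < a}
    (hσ : 0 ≤ σ) (hfl : GalerkinFloorAt a ha σ) {g : ℝ → ℂ} (hg : IsWeilTest g) (hs : tsupport g ⊆ Icc (-a) a)
    (hev : ∀ t, g (-t) = g t) (hre : ∀ t, (g t).im = 0) : -σ * ∫ t, ‖g t‖ ^ 2 ≤ (weilQuadratic g).re := by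
  refine le_of_forall_pos_le_add fun ε hε => ?_
  have hM : 0 < σ + 1 := by linarith
  obtain ⟨N, v, hn, hq⟩ := hD a ha g hg hs hev hre (ε / (σ + 1)) (div_pos hε hM)
  have hf := hfl N v
  have hn' := (abs_le.1 hn).2
  have hq' := (abs_le.1 hq).2
  have hδ : σ * (ε / (σ + 1)) + ε / (σ + 1) = ε := by field_simp
  have hstep : σ * (v ⬝ᵥ v) ≤ σ * ((∫ t, ‖g t‖ ^ 2) + ε / (σ + 1)) :=
    mul_le_mul_of_nonneg_left (by linarith) hσ
  linarith [hf, hq', hstep, hδ]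

/-- **PROVED — THE CELL'S TYPED DICTIONARY `GalerkinToContinuum zetaDatum`, modulo (ii″) only.** [folklore] -/
theorem galerkinToContinuum_of_galerkinDensity (hD : TestToGalerkinFormDensity) : GalerkinToContinuum zetaDatum := by
  intro hpos g hg hev hre
  obtain ⟨r, hr⟩ := (hg.2.isCompact.isBounded).subset_closedBall (0 : ℝ)
  have hs : tsupport g ⊆ Icc (-max r 1) (max r 1) := by
    refine hr.trans ?_
    rw [Real.closedBall_eq_Icc, zero_sub, zero_add]
    exact Icc_subset_Icc (neg_le_neg (le_max_left _ _)) (le_max_left _ _)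
  have h := re_weilQuadratic_ge_of_galerkinFloor' hD le_rfl
    (galerkinFloorAt_zero_of_allWindowsPositive hpos (max r 1) (lt_max_of_lt_right one_pos)) hg hs hev hre
  simpa using h

/-- **PROVED — GALERKIN FLOORS TRANSFER TO THE CONTINUUM EVEN GROUND ENERGY, modulo (ii″) only:** a floor `-σ`
(`σ ≥ 0`, all truncations) at half-length `a` gives `-σ ≤ ε_ev(a)`. [folklore] -/
theorem neg_le_weilEvenGroundEnergy_of_galerkinFloor' (hD : TestToGalerkinFormDensity) {a σ : ℝ} {ha : 0 < a}
    (hσ : 0 ≤ σ) (hfl : GalerkinFloorAt a ha σ) : -σ ≤ weilEvenGroundEnergy a := by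
  refine le_weilEvenGroundEnergy_of_forall ha fun g hg hs hev hn => ?_
  rw [re_weilQuadratic_eq_re_add_im hg]
  have h₁ := re_weilQuadratic_ge_of_galerkinFloor' hD hσ hfl (isWeilTest_ofReal_re hg)
    ((tsupport_ofReal_re_subset g).trans hs) (fun t => by simp [hev t]) (fun t => Complex.ofReal_im _)
  have h₂ := re_weilQuadratic_ge_of_galerkinFloor' hD hσ hfl (isWeilTest_ofReal_im hg)
    ((tsupport_ofReal_im_subset g).trans hs) (fun t => by simp [hev t]) (fun t => Complex.ofReal_im _)
  have hsum := integral_norm_sq_eq_re_add_im hg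
  rw [hn] at hsum
  nlinarith [h₁, h₂, hsum]

/-- **PROVED — THE G1.05 / G1.14 THERMOMETER REDUCTION, modulo (ii″) only (RH-strength label; conditional, no RH
claim):** Galerkin floors `-σ_k` (all truncations) at half-lengths `a_k → ∞` with `σ_k → 0` imply RH, by the tree's
thermometer `PfPersistenceM2.riemannHypothesis_of_evenGroundEnergy_floor`. [folklore] -/
theorem riemannHypothesis_of_galerkinFloors' (hD : TestToGalerkinFormDensity) {a σ : ℕ → ℝ} (ha : ∀ k, 0 < a k)
    (hat : Tendsto a atTop atTop) (hσ : Tendsto σ atTop (𝓝 0)) (hfl : ∀ k, GalerkinFloorAt (a k) (ha k) (σ k)) :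
    RiemannHypothesis := by
  refine PfPersistenceM2.riemannHypothesis_of_evenGroundEnergy_floor (σ := fun k => max (σ k) 0) hat ?_
    (Eventually.of_forall fun k => ?_)
  · simpa using hσ.max (tendsto_const_nhds (x := (0 : ℝ)))
  · exact neg_le_weilEvenGroundEnergy_of_galerkinFloor' hD (le_max_right _ _) ((hfl k).mono (le_max_left _ _))

/-- **PROVED — THE CONVERSE DIRECTION IS UNCONDITIONAL (cand-3's GAL-0 with the full bottom):** a continuum floor
`-σ ≤ ε(a)` is a Galerkin floor `-σ` at `a` for EVERY truncation. [folklore] -/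
theorem galerkinFloorAt_of_neg_le_weilGroundEnergy {a σ : ℝ} (ha : 0 < a) (h : -σ ≤ weilGroundEnergy a) :
    GalerkinFloorAt a ha σ := fun N v =>
  (mul_le_mul_of_nonneg_right h (Finset.sum_nonneg fun i _ => mul_self_nonneg (v i))).trans
    (weilGroundEnergy_mul_le_galerkinForm ⟨a, N, ha⟩ v)

/-- PROVED (corollary): under RH-free Weil positivity at half-length `a` in the ground-energy form `0 ≤ ε(a)`, every
Galerkin block of `ζ` at `a` is positive semidefinite (floor `0`, all `N`). [folklore] -/
theorem galerkinFloorAt_zero_of_weilGroundEnergy_nonneg {a : ℝ} (ha : 0 < a) (h : 0 ≤ weilGroundEnergy a) :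
    GalerkinFloorAt a ha 0 :=
  galerkinFloorAt_of_neg_le_weilGroundEnergy ha (by simpa using h)

end Summit.RiemannHypothesis.RiemannHypothesis.Theorems.PfPersistence

end
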